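import Summits.Ventures.CertifiedManyBodySolver.Upper.BlochDressedMixture
import Literature.MathematicalPhysics.QuantumLattice.HubbardNNNHoppingEnergyDensityTilingAnyParity
import Literature.MathematicalPhysics.QuantumLattice.HubbardNNNHoppingEnergyDensityConvex
import Literature.MathematicalPhysics.QuantumLattice.HubbardTTPrimeEnergyDensityVariationalPrinciple
import Literature.MathematicalPhysics.QuantumLattice.HubbardNNNHoppingRectSymmetries
import HarnessLib

/-!
# Ventures/CertifiedManyBodySolver — Upper/BlochDressedMixtureTTPrime.lean

HONEST FRAMING: first certified bounds; not a superconductivity verdict; every number certified or labelled float.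

THE PRODUCT-BERNOULLI MIXTURE STEP FOR SLATER-FUNCTIONAL UPPER BOUNDS, `t–t'` MODEL (hubbard-fast-atlas-2; step B of the
`t–t'` twin of the plaquette-dressed translation-invariant quasi-free upper chain `Upper/BlochDressed*.lean`, whose `t' = 0`
mixture step is `Upper/BlochDressedMixture.lean`; theorem-only, no certificate value appears, nothing is claimed). Setting: square
torus `(ℤ/L)²`, `L ≥ 3` EVEN, magnetic cell `k i · M i = L`, blocks `Q σ κ` Hermitian with spectra in `[0,1]`, mean filling
`n̄ = re Σ tr Q σ κ / L² ∈ (0,2)`, `U ≥ 0`, ANY real `t'`; `e = energyDensityTT' t t' U` (Ruelle limit of the `t–t'` torus energies,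
`HubbardNNNHoppingThermodynamicLimit.lean`).
* `groundEnergy_hubbardTorusTT'_full` — the filled sector of the even square `t–t'` torus: `E(2L²) = U L²` (particle–hole
  `E_{t,t'}(2L² − N) = E_{t,−t'}(N) − UN + UL²` of `HubbardNNNHoppingRectSymmetries` at `N = 0`, vacuum energy `0`);
* `line_le_groundEnergy_torusTT'_div` — for a supporting line `s` of the convex `e` at `n̄` and EVERY `N ≤ 2L²`:
  `e(n̄) + s (N/L² − n̄) ≤ E_{(ℤ/L)²}(t,t',U;N)/L² + (16|t| + 32|t'|)/L` (sectors `N < 2L²` by the any-parity tiling bound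
  `energyDensityTT'_le_torus_of_lt`; the filled sector by the previous item and `supporting_line_energyDensityTT'_at_two_le`);
* **`energyDensityTT'_le_avg_of_slaterBound`** — for ANY real functional `D` of one-body matrices that bounds the `t–t'` torus ground
  energy on orthogonal projections (`P = Pᴴ = P²`, `tr P = N` ⇒ `E(N) ≤ D P`):
  `e(n̄) ≤ (Σ_E W(E) · D(P_E)) / L² + (16|t| + 32|t'|)/L`, the sum over all product-Bernoulli patterns `E` with members
  `P_E = spinBlock (σ ↦ blochMatrix (κ ↦ bernoulliProj (Q σ κ) (E (σ,κ))))` and weights `W(E) = Π w` — VERBATIM the `t' = 0`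
  proof (`energyDensity2D_le_avg_of_slaterBound`) with the `t–t'` tiling bound and supporting line.
The plaquette-dressed INSTANCE (`D = re` dressed functional of `PlaquetteLUC.groundEnergy_torusTT'_le_dressed`, corner windows) is
the next file of the twin chain. Sources: Lieb 1981 (variational principle) [Lieb1981]; Bach–Lieb–Solovej 1994 (2c.36) [BachLiebSolovej1994];
Lieb–Wu 2003 §1 eq. (3) (particle–hole) [LiebWuPhysicaA2003]; Ruelle 1969 §3.3 (tiling) [Ruelle1969]. Everything proved; no definition.
-/

noncomputable section

namespace Summit.Ventures.CertifiedManyBodySolver.Upper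

open Matrix Finset
open Literature.MathematicalPhysics.QuantumLattice Literature.MathematicalPhysics.QuantumLattice.HartreeFock
  Literature.MathematicalPhysics.QuantumLattice.ThermodynamicLimit HubbardWave0
open scoped ComplexOrder ComplexConjugate

/-! ### §1. The vacuum and the filled sector of the `t–t'` torus -/

/-- The vacuum sector of an operator annihilating the vacuum has energy `0` (the only unit `0`-particle vectors are phases
times `|∅⟩`). [folklore] -/
theorem groundEnergy_zero_of_mulVec_vacuum {ι : Type*} [LinearOrder ι] [Fintype ι]
    (H : Matrix (Finset ι) (Finset ι) ℂ) (hH : H *ᵥ (vacuum : Fock ι) = 0) :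
    Literature.MathematicalPhysics.QuantumLattice.groundEnergy H 0 = 0 := by
  have hset : {E : ℝ | ∃ ψ : Fock ι, IsNParticle 0 ψ ∧ star ψ ⬝ᵥ ψ = 1 ∧
      E = (Literature.MathematicalPhysics.QuantumLattice.expect H ψ).re} = {0} := by
    ext E
    simp only [Set.mem_setOf_eq, Set.mem_singleton_iff]
    constructor
    · rintro ⟨ψ, hψ, -, rfl⟩
      have hvac : ψ = ψ ∅ • (vacuum : Fock ι) := by
        funext s
        rw [Pi.smul_apply, vacuum, Pi.single_apply, smul_eq_mul]
        by_cases hs : s = ∅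
        · subst hs; rw [if_pos rfl, mul_one]
        · rw [if_neg hs, mul_zero, hψ s (fun h => hs (Finset.card_eq_zero.1 h))]
      rw [Literature.MathematicalPhysics.QuantumLattice.expect, hvac, mulVec_smul, hH, smul_zero, dotProduct_zero, Complex.zero_re]
    · rintro rfl
      refine ⟨vacuum, ?_, ?_, ?_⟩
      · intro s hs
        rw [vacuum, Pi.single_apply, if_neg]
        exact fun h => hs (by rw [h, Finset.card_empty])
      · rw [vacuum, dotProduct_single, Pi.star_apply, Pi.single_eq_same, star_one, one_mul]
      · rw [Literature.MathematicalPhysics.QuantumLattice.expect, hH, dotProduct_zero, Complex.zero_re]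
  rw [Literature.MathematicalPhysics.QuantumLattice.groundEnergy, hset, csInf_singleton]

/-- The vacuum sector of the rectangular `t–t'` torus has energy `0`. [folklore] -/
theorem groundEnergy_hubbardRectTorusTT'_zero (a b : ℕ) (t t' U : ℝ) :
    groundEnergy (hubbardRectTorusTT' a b t t' U) 0 = 0 :=
  groundEnergy_zero_of_mulVec_vacuum _ (by
    rw [hubbardRectTorusTT', Matrix.add_mulVec, hamiltonian_mulVec_vacuum, hamiltonian_mulVec_vacuum, add_zero])

/-- **The filled sector of the even square `t–t'` torus**: `E_{(ℤ/L)²}(t,t',U; 2L²) = U L²` (particle–hole symmetry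
`E_{t,t'}(2L² − N) = E_{t,−t'}(N) − UN + UL²` at `N = 0` and the vacuum energy `0`). [cite: LiebWuPhysicaA2003, §1 eq. (3)] -/
theorem groundEnergy_hubbardTorusTT'_full {L : ℕ} (hLe : Even L) (t t' U : ℝ) :
    groundEnergy (hubbardTorusTT' L t t' U) (2 * (L * L)) = U * (L : ℝ) ^ 2 := by
  rw [groundEnergy_hubbardTorusTT'_eq_rect]
  have h := groundEnergy_hubbardRectTorusTT'_particleHole hLe hLe t t' U (N := 0) (Nat.zero_le _)
  rw [Nat.sub_zero, groundEnergy_hubbardRectTorusTT'_zero] at h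
  rw [h]
  push_cast
  ring

/-! ### §2. One line below every sector energy -/

/-- **A supporting line of `e = energyDensityTT' t t' U` lies below every sector energy of the square torus (up to the tiling
error).** For `U ≥ 0`, `L ≥ 1` even, a supporting line `x ↦ e(n̄) + s(x − n̄)` of the convex energy density on `[0,2)`, and every
particle number `N ≤ 2L²`: `e(n̄) + s(N/L² − n̄) ≤ E_{(ℤ/L)²}(t,t',U;N)/L² + (16|t| + 32|t'|)/L`. Sectors `N < 2L²`: the any-parity
tiling bound; the filled sector: `E(2L²) = U L²` and `e(n̄) + s(2 − n̄) ≤ U`. [cite: Ruelle1969, §3.3] -/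
theorem line_le_groundEnergy_torusTT'_div {L : ℕ} (hL1 : 1 ≤ L) (hLe : Even L) (t t' : ℝ) {U : ℝ} (hU : 0 ≤ U) {ρ s : ℝ}
    (hs : ∀ x ∈ Set.Ico (0 : ℝ) 2, energyDensityTT' t t' U ρ + s * (x - ρ) ≤ energyDensityTT' t t' U x) {N : ℕ}
    (hN : N ≤ 2 * (L * L)) :
    energyDensityTT' t t' U ρ + s * ((N : ℝ) / (L : ℝ) ^ 2 - ρ) ≤
      groundEnergy (hubbardTorusTT' L t t' U) N / (L : ℝ) ^ 2 + (16 * |t| + 32 * |t'|) / L := by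
  have hL0 : (0 : ℝ) < L := by exact_mod_cast hL1
  have hL2 : (0 : ℝ) < (L : ℝ) ^ 2 := by positivity
  rcases Nat.lt_or_ge N (2 * (L * L)) with hlt | hge
  · have hNr : (N : ℝ) / (L : ℝ) ^ 2 ∈ Set.Ico (0 : ℝ) 2 := by
      refine ⟨by positivity, ?_⟩
      rw [div_lt_iff₀ hL2]
      have h' : ((N : ℕ) : ℝ) < ((2 * (L * L) : ℕ) : ℝ) := Nat.cast_lt.mpr hlt
      push_cast at h'
      nlinarith
    exact (hs _ hNr).trans (energyDensityTT'_le_torus_of_lt t t' hU hL1 hlt)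
  · have hNeq : N = 2 * (L * L) := le_antisymm hN hge
    subst hNeq
    have htwo : (((2 * (L * L) : ℕ) : ℝ) / (L : ℝ) ^ 2) = 2 := by
      push_cast; field_simp
    rw [htwo, groundEnergy_hubbardTorusTT'_full hLe, mul_div_assoc, div_self hL2.ne', mul_one]
    have h5 := supporting_line_energyDensityTT'_at_two_le t t' hU hs
    have h6 : 0 ≤ (16 * |t| + 32 * |t'|) / (L : ℝ) := by positivity
    linarith

/-! ### §3. The mixture step for an arbitrary Slater functional bound, `t–t'` model -/

section Mixture

variable {L : ℕ} [NeZero L] {k M : Fin 2 → ℕ} [∀ i, NeZero (k i)] [∀ i, NeZero (M i)]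

/-- **Lieb's variational principle, mixture form, for an arbitrary Slater functional bound — `t–t'` Hubbard model.** On the
even torus `(ℤ/L)²`, `L ≥ 3`, with a magnetic cell `k i · M i = L`: let `D` be a real functional of one-body matrices with
`E_{t,t',U}(N) ≤ D P` for every orthogonal projection `P` of trace `N`. Then for blocks `Q σ κ` with spectra in `[0,1]` and mean
filling `n̄ ∈ (0,2)`, `e(t,t',U;n̄) ≤ (Σ_E W(E) D(P_E))/L² + (16|t| + 32|t'|)/L`, the product-Bernoulli average over the Slater
members `P_E`. [cite: Lieb1981, eq. (4)] -/
theorem energyDensityTT'_le_avg_of_slaterBound (hkM : ∀ i, k i * M i = L) (hL : 3 ≤ L) (hLe : Even L) (t t' : ℝ) {U : ℝ}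
    (hU : 0 ≤ U)
    (Q : Fin 2 → RectTorusSite k → Matrix (RectTorusSite M) (RectTorusSite M) ℂ) (hQh : ∀ σ κ, (Q σ κ).IsHermitian)
    (h0 : ∀ σ κ i, 0 ≤ (hQh σ κ).eigenvalues i) (h1 : ∀ σ κ i, (hQh σ κ).eigenvalues i ≤ 1)
    (hn0 : 0 < (∑ σ, ∑ κ, (Q σ κ).trace).re / (L : ℝ) ^ 2) (hn2 : (∑ σ, ∑ κ, (Q σ κ).trace).re / (L : ℝ) ^ 2 < 2)
    (D : Matrix (Orb (FermionTorus 2 L)) (Orb (FermionTorus 2 L)) ℂ → ℝ)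
    (hD : ∀ (P : Matrix (Orb (FermionTorus 2 L)) (Orb (FermionTorus 2 L)) ℂ), P.IsHermitian → P * P = P →
      ∀ N : ℕ, P.trace = N → groundEnergy (hubbardTorusTT' L t t' U) N ≤ D P) :
    energyDensityTT' t t' U ((∑ σ, ∑ κ, (Q σ κ).trace).re / (L : ℝ) ^ 2) ≤
      (∑ E : Fin 2 × RectTorusSite k → RectTorusSite M → Bool,
          (∏ b : Fin 2 × RectTorusSite k, bernoulliWeight (hQh b.1 b.2) (E b)) *
            D (spinBlock fun σ => blochMatrix hkM fun κ => bernoulliProj (hQh σ κ) (E (σ, κ)))) / (L : ℝ) ^ 2 +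
        (16 * |t| + 32 * |t'|) / L := by
  classical
  set nbar := (∑ σ, ∑ κ, (Q σ κ).trace).re / (L : ℝ) ^ 2 with hnbar
  set C : ℝ := (16 * |t| + 32 * |t'|) / L with hC
  have hL0 : (0 : ℝ) < L := by exact_mod_cast (show 0 < L by omega)
  have hL2 : (0 : ℝ) < (L : ℝ) ^ 2 := by positivity
  obtain ⟨s, hs⟩ := exists_supporting_line_energyDensityTT' t t' hU hn0 hn2
  -- abbreviations: weights, member families, member particle numbers
  obtain ⟨W, hW⟩ : ∃ W : (Fin 2 × RectTorusSite k → RectTorusSite M → Bool) → ℝ,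
      W = fun E => ∏ b : Fin 2 × RectTorusSite k, bernoulliWeight (hQh b.1 b.2) (E b) := ⟨_, rfl⟩
  obtain ⟨cnt, hcnt⟩ : ∃ cnt : (Fin 2 × RectTorusSite k → RectTorusSite M → Bool) → ℕ,
      cnt = fun E => ∑ b : Fin 2 × RectTorusSite k, (Finset.univ.filter fun i => E b i = true).card := ⟨_, rfl⟩
  have hWE : ∀ E, (∏ b : Fin 2 × RectTorusSite k, bernoulliWeight (hQh b.1 b.2) (E b)) = W E := fun E => by rw [hW]
  simp_rw [hWE]
  have hW0 : ∀ E, 0 ≤ W E := fun E => by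
    rw [hW]; exact prodWeight_nonneg (fun b : Fin 2 × RectTorusSite k => hQh b.1 b.2) (fun b i => h0 b.1 b.2 i) (fun b i => h1 b.1 b.2 i) E
  have hW1 : ∑ E, W E = 1 := by rw [hW]; exact sum_prodWeight (fun b : Fin 2 × RectTorusSite k => hQh b.1 b.2)
  have hWN : ∑ E, W E * (cnt E : ℝ) = nbar * (L : ℝ) ^ 2 := by
    have h := sum_prodWeight_mul_sum_card (fun b : Fin 2 × RectTorusSite k => hQh b.1 b.2)
    have hc : ∀ E, (cnt E : ℝ) = ∑ b : Fin 2 × RectTorusSite k, ((Finset.univ.filter fun i => E b i = true).card : ℝ) := by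
      intro E; rw [hcnt]; push_cast; rfl
    simp_rw [hc, hW]
    rw [h, hnbar, div_mul_cancel₀ _ hL2.ne', Complex.re_sum, Fintype.sum_prod_type]
    refine Finset.sum_congr rfl fun σ _ => ?_
    rw [Complex.re_sum]
    refine Finset.sum_congr rfl fun κ _ => ?_
    rw [(hQh σ κ).trace_eq_sum_eigenvalues]
    norm_cast
  -- the member inequality
  have hmember : ∀ E : Fin 2 × RectTorusSite k → RectTorusSite M → Bool,
      energyDensityTT' t t' U nbar + s * ((cnt E : ℝ) / (L : ℝ) ^ 2 - nbar) ≤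
        D (spinBlock fun σ => blochMatrix hkM fun κ => bernoulliProj (hQh σ κ) (E (σ, κ))) / (L : ℝ) ^ 2 + C := by
    intro E
    have hPh := isHermitian_spinBlock_blochMatrix hkM (fun σ κ => bernoulliProj (hQh σ κ) (E (σ, κ)))
      (fun σ κ => isHermitian_bernoulliProj _ _)
    have hPP := spinBlock_blochMatrix_mul_self hkM (fun σ κ => bernoulliProj (hQh σ κ) (E (σ, κ)))
      (fun σ κ => bernoulliProj_mul_self _ _)
    have htr : (spinBlock fun σ => blochMatrix hkM fun κ => bernoulliProj (hQh σ κ) (E (σ, κ))).trace = (cnt E : ℂ) := by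
      rw [trace_spinBlock_blochMatrix hkM (fun σ κ => bernoulliProj (hQh σ κ) (E (σ, κ))), hcnt]
      push_cast
      rw [Fintype.sum_prod_type]
      exact Finset.sum_congr rfl fun σ _ => Finset.sum_congr rfl fun κ _ => trace_bernoulliProj _ _
    have hle : cnt E ≤ 2 * (L * L) := by
      have hb : ∀ b ∈ (Finset.univ : Finset (Fin 2 × RectTorusSite k)),
          (Finset.univ.filter fun i => E b i = true).card ≤ Fintype.card (RectTorusSite M) :=
        fun b _ => (Finset.card_filter_le _ _).trans (by rw [Finset.card_univ])
      have h := Finset.sum_le_sum hb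
      rw [Finset.sum_const, Finset.card_univ, smul_eq_mul, Fintype.card_prod, Fintype.card_fin] at h
      have hcard : Fintype.card (RectTorusSite k) * Fintype.card (RectTorusSite M) = L * L := by
        rw [HeisenbergTL.card_rectTorusSite_eq_prod, HeisenbergTL.card_rectTorusSite_eq_prod, ← Finset.prod_mul_distrib,
          Finset.prod_congr rfl fun i _ => hkM i, Finset.prod_const, Finset.card_univ, Fintype.card_fin, sq]
      rw [hcnt]
      calc _ ≤ 2 * Fintype.card (RectTorusSite k) * Fintype.card (RectTorusSite M) := h
        _ = 2 * (L * L) := by rw [mul_assoc, hcard]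
    have hline := line_le_groundEnergy_torusTT'_div (show 1 ≤ L by omega) hLe t t' hU hs hle
    have hDm := hD _ hPh hPP (cnt E) htr
    have h4 := div_le_div_of_nonneg_right hDm hL2.le
    rw [← hC] at hline
    linarith
  -- average the member inequalities with the weights
  have key : ∑ E, W E * (energyDensityTT' t t' U nbar + s * ((cnt E : ℝ) / (L : ℝ) ^ 2 - nbar)) ≤
      ∑ E, W E * (D (spinBlock fun σ => blochMatrix hkM fun κ => bernoulliProj (hQh σ κ) (E (σ, κ))) / (L : ℝ) ^ 2 + C) :=
    Finset.sum_le_sum fun E _ => mul_le_mul_of_nonneg_left (hmember E) (hW0 E)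
  have eqL : ∑ E, W E * (energyDensityTT' t t' U nbar + s * ((cnt E : ℝ) / (L : ℝ) ^ 2 - nbar)) = energyDensityTT' t t' U nbar := by
    have hsplit : ∀ E, W E * (energyDensityTT' t t' U nbar + s * ((cnt E : ℝ) / (L : ℝ) ^ 2 - nbar)) =
        W E * energyDensityTT' t t' U nbar + (s / (L : ℝ) ^ 2) * (W E * (cnt E : ℝ)) - W E * (s * nbar) := fun E => by
      field_simp; ring
    rw [Finset.sum_congr rfl fun E _ => hsplit E, Finset.sum_sub_distrib, Finset.sum_add_distrib, ← Finset.sum_mul, hW1, one_mul,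
      ← Finset.mul_sum, hWN, ← Finset.sum_mul, hW1, one_mul]
    field_simp
    ring
  have eqR : ∑ E, W E * (D (spinBlock fun σ => blochMatrix hkM fun κ => bernoulliProj (hQh σ κ) (E (σ, κ))) / (L : ℝ) ^ 2 + C) =
      (∑ E, W E * D (spinBlock fun σ => blochMatrix hkM fun κ => bernoulliProj (hQh σ κ) (E (σ, κ)))) / (L : ℝ) ^ 2 + C := by
    have hsplit : ∀ E, W E * (D (spinBlock fun σ => blochMatrix hkM fun κ => bernoulliProj (hQh σ κ) (E (σ, κ))) / (L : ℝ) ^ 2 +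
        C) = W E * D (spinBlock fun σ => blochMatrix hkM fun κ => bernoulliProj (hQh σ κ) (E (σ, κ))) / (L : ℝ) ^ 2 +
          W E * C := fun E => by ring
    rw [Finset.sum_congr rfl fun E _ => hsplit E, Finset.sum_add_distrib, ← Finset.sum_mul, hW1, one_mul, Finset.sum_div]
  linarith [key, eqL, eqR]

end Mixture

end Summit.Ventures.CertifiedManyBodySolver.Upper
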